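import Summits.ABC.IUTFork.Cor312NaiveEncodes
import Summits.ABC.IUTFork.Cor312IdentifiedContentful
import HarnessLib

/-!
# The naive `p`-adic model, IV-b: the Cor. 3.12 FORK over ONE contentful instance of the typed Theorem 3.11

Record-only, PROOF-ONLY file (D-0012) of the abc-iut cell (D-0067 adjudication, ADJUDICATION-SPEC v2.1 §2 (G3) and
(R), §4 (iii); seat abc-iut-w5-d247); TAKES NO SIDE.  It only ASSEMBLES, by name, the two landed halves over the
SAME contentful instance `naiveFull 2` of c312-1's typed [IUTchIII] Thm. 3.11 (`Cor312NaiveThm311`: nonzero theta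
values in the splitting monoids, proper shells, sign-twisted Kummer transport, non-trivial link data):
* the NATURAL glue `naiveSetting` (abc-iut-w5-d247, `Cor312GapWitnessContentful` / `Cor312NaiveEncodes`): every
  bridge hypothesis, `|log(q)| > 0`, the Step-(v) ENCODING `−|log(Θ)| = stepVWeight·(−|log(q)|)`, typed Cor. 3.12
  FALSE, not the identified reading;
* the IDENTIFIED glue `identifiedSetting` (abc-iut-w5-d232, `Cor312IdentifiedContentful`): every bridge hypothesis,
  `|log(q)| > 0`, Team R's `IdentifiedReading`, typed Cor. 3.12 TRUE (attained), NO encoding of weight `> 1`;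
into ONE kernel statement `cor312_fork_over_contentful_thm311`: the two settings have the same column index, the
same hull frames and the same q-pilot image (kernel: `rfl`) — they differ only in the Θ-glue field
`Setting.thetaRegionOf` — and the verbatim Corollary takes OPPOSITE truth values on them.  At the level of OUR typed
interfaces, over a contentful Thm. 3.11 instance, the Corollary is decided by the free glue field alone: the (G)
finding (A1 `GapWitness`, GAP-LEDGER G-c312-9-1) and the (R) finding (R-1) side by side on one non-degenerate
model.  Interface level; no judgement on print; no `Prop` fact; standard axioms.
[claim: Mochizuki2012, status: disputed] [cite: ScholzeStix2018, §2.2 pp. 9–10]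
-/

noncomputable section

namespace Summit.ABC

namespace IUTFork

namespace Cor312Vol

namespace NaiveWitness

open Thm311 Cor312 Cor312.Checks Literature.IUT.LogThetaLattice

/-- **THE Cor. 3.12 FORK OVER ONE CONTENTFUL INSTANCE OF THE TYPED Thm. 3.11.**  There are an index skeleton, ONE
full situation `F` satisfying the typed [IUTchIII] Thm. 3.11 (i) ∧ (ii) ∧ (iii) with contentful data (nonempty
zero-free splitting monoids, nonempty number-field copies, proper shells strictly containing the `m' = 1` unit
image, non-identity theater automorphisms, a non-trivially acting (Ind1),(Ind2)-group), and TWO verbatim settings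
`P₁`, `P₂` over `F` with the same column index, the same hull frames and the same q-pilot image, both satisfying
every bridge hypothesis and `|log(q)| > 0`, such that `P₁` (natural glue: Θ ↦ `λ·𝒪` of radius `|q^{j²}|`)
satisfies the Step-(v) ENCODING `−|log(Θ)| = stepVWeight·(−|log(q)|)`, VIOLATES the typed Cor. 3.12 and is not the
identified reading, while `P₂` (identified glue) satisfies Team R's `IdentifiedReading` and the typed Cor. 3.12
(attained: `−|log(Θ)| = −|log(q)|`) and violates every Θ-degree encoding of weight `> 1`.  (`P₁ = naiveSetting 2`,
abc-iut-w5-d247; `P₂ = identifiedSetting 2`, abc-iut-w5-d232.) [folklore] -/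
theorem cor312_fork_over_contentful_thm311 :
    ∃ (T : ThetaIndex) (F : FullSituation T) (P₁ P₂ : Setting F.toLatticeSituation.toSituation),
      F.Statement ∧
      (∀ (n : ℤ) (v : T.V) (hv : v ∈ T.Vbad),
        ((F.D n).Ψ v hv).Nonempty ∧ (0 : F.L.StarPacket v) ∉ (F.D n).Ψ v hv) ∧
      (∀ (n : ℤ) (j : T.LabelStar), ((F.D n).Mmod j).Nonempty) ∧
      (∀ (n : ℤ) (j : T.Label) (vQ : T.VQ) (m : ℤ), (F.col n).unitImage m 1 j vQ ⊂ (F.D n).shellPk j vQ) ∧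
      (∀ n m : ℤ, ∃ a : F.link.AutHT n m, F.link.onDelta n m a ≠ CategoryTheory.Iso.refl _) ∧
      (∃ Φ ∈ Setting.indGroup F.toSituation, ∃ (j : T.Label) (vQ : T.VQ) (x : F.L.Packet j vQ),
        Φ j vQ x ≠ x) ∧
      (P₂.n = P₁.n ∧ P₂.frame = P₁.frame ∧ ∀ (j : T.Label) (vQ : T.VQ), P₂.qRegion j vQ = P₁.qRegion j vQ) ∧
      (BridgeHyps P₁ ∧ P₁.AbsLogQPos ∧
        P₁.negLogTheta = ((stepVWeight T * P₁.negLogQ : ℝ) : WithTop ℝ) ∧ ¬ P₁.Statement ∧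
          ¬ P₁.IdentifiedReading) ∧
      (BridgeHyps P₂ ∧ P₂.AbsLogQPos ∧ P₂.IdentifiedReading ∧ P₂.Statement ∧
        P₂.negLogTheta = ((P₂.negLogQ : ℝ) : WithTop ℝ) ∧
          ¬ ∃ w : ℝ, 1 < w ∧ P₂.negLogTheta = ((w * P₂.negLogQ : ℝ) : WithTop ℝ)) := by
  haveI : Fact (Nat.Prime 2) := ⟨Nat.prime_two⟩
  refine ⟨toyIndex, naiveFull 2, naiveSetting 2, identifiedSetting 2, naiveFull_statement 2,
    fun n v hv => ⟨⟨thetaValues 2 v, thetaValues_mem_Psi 2 v⟩, zero_notMem_Psi 2 v⟩,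
    fun _ _ => ⟨0, Set.mem_univ _⟩, fun n j vQ m => ?_, fun n m => ⟨(-1 : ℤˣ), unitIso_neg_one_ne_refl⟩,
    naive_indGroup_nontrivial 2, ⟨rfl, rfl, fun _ _ => rfl⟩,
    ⟨naiveSetting_bridgeHyps 2, naiveSetting_absLogQPos 2, naiveSetting_encodes 2, naiveSetting_not_statement 2,
      naiveSetting_not_identifiedReading 2⟩,
    ⟨identifiedSetting_bridgeHyps 2, identifiedSetting_absLogQPos 2, identifiedSetting_reading 2,
      identifiedSetting_statement 2, (identifiedSetting_reading 2).negLogTheta_eq,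
      (identifiedSetting_reading 2).not_encodes (identifiedSetting_absLogQPos 2)⟩⟩
  show pBall 2 j vQ ((1 : ℕ) + 1 : ℤ) ⊂ pBall 2 j vQ 0
  exact (pBall_succ_ssubset 2 j vQ 1).trans_subset (pBall_mono 2 j vQ (by norm_num))

end NaiveWitness

end Cor312Vol

end IUTFork

end Summit.ABC

end
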